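import Summits.CriticalPhenomena.PercolationContinuityZ3.Theorems.Transplant.SiteKNStepIII
import HarnessLib

/-!
# SITE Kozma–Nitzan §4 — the supercriticality bound (33) of the site scheme: the chain (36)–(37) and the sum over
# the onward directions

builds on p205010 (kernel theorem, internal audit signed; external expert review pending).
Lane `prim-bschramm`, class C1a (site percolation on `ℤ³`); block (γ) of the SITE same-`p` witness
(`SiteSameP.SiteSamePWitnessZd`, socket p217536), prim-hp-8 lineage.  Site twin of the probabilistic half of
`L/KozmaNitzanSteps.lean` (`KSch.Bev` … `KSch.fail_bound`).  Helper file (`--supports stmt-CriticalPhenomena-4575`).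

After a valid history of the site scheme and for an onward direction `x = v + du`, under the weighting `μ = Wfull`
(density `p` pinned on the recorded vertex pattern of `E_i`, restricted to `E_i ∪ E_{w,v} ∪ E_{v,x}`):

* the events `B_j` (`Bev`: the conditional probability (30) of reaching `F^{j+1}` given the sites of
  `E_i ∪ E_{w,v} ∪ H^j` is `≤ 1 − δ₂`), `G_j = ⋂_{i<j} (A'_i ∩ B_i)` (`Gev`) and "no good level" (`bad`), their
  determination by the sites of the level regions;
* `pinW_Wfull_eq_Wt` — pinning `μ` on the sites of the level-`j` region along a pattern extending the record IS the
  weighting of (30) ("usual percolation on this auxiliary graph is identical to conditioned percolation", p. 30);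
* `real_Gev_le` — the chain (36): `μ(G_j ∩ [ξ]) ≤ (1 − δ₂)^j`; `real_bad_le` — (36)–(37): `μ(bad) ≤ (1 − δ₂)^K + ε'`
  given the site Lemma 12 (`reach_bound`) and the site target lemma (`cond_of_face`);
* `real_bad_eq` — back to `P^{site}_p` (Step II); **`fail_bound`** — (33): the examination fails with
  `P^{site}_p`-probability at most `ε`, read on the open vertices of the envelope region; `measurableSet_fail`.
[cite: KozmaNitzan2024, §4 pp. 28–31 ((33), Steps I–IV, (36), (37))]
-/

noncomputable section

namespace Summit.CriticalPhenomena.PercolationContinuityZ3.Theorems.Transplant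

namespace SiteKN

open MeasureTheory ProbabilityTheory
open Literature.Probability.Percolation Literature.Probability.LatticeModels
open Literature.Probability.Percolation.KozmaNitzan Literature.Probability.Percolation.KozmaNitzan.Cells
open GadgetSystem ProbeHistory Contour
open SiteTransplant (siteConn mem_siteConn)
open scoped Classical

variable {d : ℕ}

namespace SKSch

variable (S : SKSch d)
/-! ## The events of Step IV -/

/-- **The event `B_j`** `= {P(0 ↔ F^{j+1}_{v,x} | sites of E_i ∪ E_{w,v} ∪ H^j_{v,x}) ≤ 1 − δ₂}`, the conditional probability
being that of (30) at level `j` for the open vertices of `σ` in the envelope region. [cite: KozmaNitzan2024, §4 p. 30 (B_j)] -/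
def Bev (h : ProbeHistory (Option (Site d))) (e : Site 2 × MDir) (du : MDir) (j : ℕ) (δ₂ : ℝ) : Set (SiteConfig (Site d)) :=
  {σ | (prodBernoulli (S.Wt h e du j (obsV σ (S.envV h e)))).real
      (⋃ b ∈ S.C.Face (tgt e) du (j + 1), siteConn (zdGraph d) (0 : Site d) b) ≤ 1 - δ₂}

/-- `G_j = ⋂_{i<j} (A'_i ∩ B_i)`. [cite: KozmaNitzan2024, §4 p. 31 ((36))] -/
def Gev (h : ProbeHistory (Option (Site d))) (e : Site 2 × MDir) (du : MDir) (δ₂ : ℝ) : ℕ → Set (SiteConfig (Site d))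
  | 0 => Set.univ
  | j + 1 => S.Aface h e du j ∩ (S.Bev h e du j δ₂ ∩ Gev h e du δ₂ j)

/-- **A bad direction**: the connection `v–x` is good at no level. [cite: KozmaNitzan2024, §4 p. 27 (j_x), p. 31] -/
def bad (h : ProbeHistory (Option (Site d))) (e : Site 2 × MDir) (du : MDir) : Set (SiteConfig (Site d)) :=
  {σ | ∀ j < S.C.K, ¬S.cond h e du j (obsV σ (S.envV h e))}

/-- **The failure event of the examination**, read on the open vertices of the envelope region. [cite: KozmaNitzan2024, §4 p. 27] -/
def fail (h : ProbeHistory (Option (Site d))) (e : Site 2 × MDir) : Set (SiteConfig (Site d)) :=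
  {σ | ¬S.succV h e (obsV σ (S.envV h e))}

variable {S}
/-! ## Determination and measurability -/

/-- Observations of configurations agreeing on `F` agree on `F`. [folklore] -/
theorem obsV_agree {F : Set (Site d)} {σ σ' : SiteConfig (Site d)} (h : σ ∩ F = σ' ∩ F) {A : Finset (Site d)}
    {x : Site d} (hx : x ∈ F) : x ∈ obsV σ A ↔ x ∈ obsV σ' A := by
  simp only [mem_obsV_iff]
  refine and_congr_right fun _ => ⟨fun h1 => ?_, fun h1 => ?_⟩
  · exact ((Set.ext_iff.1 h x).1 ⟨h1, hx⟩).1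
  · exact ((Set.ext_iff.1 h x).2 ⟨h1, hx⟩).1

/-- `B_j` is determined by the sites of the level-`j` region. [folklore] -/
theorem determinedBy_Bev (S : SKSch d) (h : ProbeHistory (Option (Site d))) (e : Site 2 × MDir) (du : MDir) (j : ℕ) (δ₂ : ℝ) :
    DeterminedBy (S.Bev h e du j δ₂) (↑(S.Rj h e du j) : Set (Site d)) := by
  rw [determinedBy_iff]
  intro σ σ' hσσ'
  have key : S.pat h e du j (obsV σ (S.envV h e)) = S.pat h e du j (obsV σ' (S.envV h e)) :=
    S.pat_congr h e du j fun x hx => obsV_agree hσσ' (Finset.mem_coe.2 (Finset.mem_sdiff.1 hx).1)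
  simp only [Bev, Set.mem_setOf_eq, Wt, key]

/-- A bad direction is determined by the fresh sites of the level-`K-1` region. [folklore] -/
theorem determinedBy_bad (S : SKSch d) (h : ProbeHistory (Option (Site d))) (e : Site 2 × MDir) (du : MDir) :
    DeterminedBy (S.bad h e du) (↑(S.Rj h e du (S.C.K - 1) \ S.V h) : Set (Site d)) := by
  rw [determinedBy_iff]
  intro σ σ' hσσ'
  simp only [bad, Set.mem_setOf_eq]
  refine forall₂_congr fun j hj => not_congr (S.cond_congr h e du j fun x hx => obsV_agree hσσ' ?_)
  exact Finset.mem_coe.2 (Finset.mem_sdiff.2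
    ⟨S.Rj_mono h e du (by omega) (Finset.mem_sdiff.1 hx).1, (Finset.mem_sdiff.1 hx).2⟩)

/-- The failure event is determined by the sites of the envelope region. [folklore] -/
theorem determinedBy_fail (S : SKSch d) (h : ProbeHistory (Option (Site d))) (e : Site 2 × MDir) :
    DeterminedBy (S.fail h e) (↑(S.envV h e) : Set (Site d)) := by
  rw [determinedBy_iff]
  intro σ σ' hσσ'
  have : obsV σ (S.envV h e) = obsV σ' (S.envV h e) := by
    ext x
    by_cases hx : x ∈ S.envV h e
    · exact obsV_agree hσσ' (Finset.mem_coe.2 hx)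
    · simp only [mem_obsV_iff, hx, false_and]
  simp only [fail, Set.mem_setOf_eq, this]

/-- The failure event is measurable. [folklore] -/
theorem measurableSet_fail (S : SKSch d) (h : ProbeHistory (Option (Site d))) (e : Site 2 × MDir) :
    MeasurableSet (S.fail h e) :=
  (determinedBy_fail S h e).measurableSet_of_finset

/-- `A'_j` is determined by the sites of the level-`j+1` region. [folklore] -/
theorem determinedBy_Aface (S : SKSch d) (h : ProbeHistory (Option (Site d))) (e : Site 2 × MDir) (du : MDir) (j : ℕ) :
    DeterminedBy (S.Aface h e du j) (↑(S.Rj h e du (j + 1)) : Set (Site d)) :=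
  determinedBy_biUnion_siteConnIn _ _ _ _

/-- `G_j` is determined by the sites of the level-`j` region. [folklore] -/
theorem determinedBy_Gev (S : SKSch d) (h : ProbeHistory (Option (Site d))) (e : Site 2 × MDir) (du : MDir) (δ₂ : ℝ) :
    ∀ j, DeterminedBy (S.Gev h e du δ₂ j) (↑(S.Rj h e du j) : Set (Site d))
  | 0 => determinedBy_univ _
  | j + 1 => by
    have hmono : (↑(S.Rj h e du j) : Set (Site d)) ⊆ ↑(S.Rj h e du (j + 1)) :=
      Finset.coe_subset.2 (S.Rj_mono h e du (Nat.le_succ j))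
    refine (determinedBy_Aface S h e du j).inter (DeterminedBy.inter ?_ ((determinedBy_Gev S h e du δ₂ j).mono hmono))
    exact (determinedBy_Bev S h e du j δ₂).mono hmono

section Setting

variable {h : ProbeHistory (Option (Site d))} {e : Site 2 × MDir} (hV : S.Valid h e) {du : MDir}
  (hdu : du ∈ S.onward h (tgt e))
include hV hdu
/-! ## Almost surely the record is read back -/

omit hV hdu in
/-- Under `μ` the pattern on the explored vertices is the recorded one, almost surely. [folklore] -/
theorem ae_cyl : ∀ᵐ σ ∂prodBernoulli (S.Wfull h e du), σ ∈ localCylinder (↑(S.V h) : Set (Site d)) ↑(S.ξ h) := by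
  have : S.Wfull h e du = pinW (siteRestrW (↑(S.Sx h e du) : Set (Site d)) fun _ : Site d => S.p) ↑(S.V h) ↑(S.ξ h) := by
    unfold Wfull
    exact siteRestrW_pinW_comm _ _ (Finset.coe_subset.2 fun y hy => Finset.mem_union_left _ (Finset.mem_union_left _ hy))
  rw [this]
  exact prodBernoulli_pinW_ae_localCylinder _ (S.V h).finite_toSet.countable _
/-! ## The transfer: pinning `μ` on the sites of level `j` gives the weighting of (30) -/

/-- **Under `μ` pinned on the sites of `E_i ∪ E_{w,v} ∪ H^j` along a pattern `T` extending the record of `E_i`, the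
weighting is that of (30) at level `j` for the observation `T`.**
[cite: KozmaNitzan2024, §4 p. 30 (Step III: "usual percolation on this auxiliary graph is identical to conditioned percolation on Ω")] -/
theorem pinW_Wfull_eq_Wt {j : ℕ} (hj : j < S.C.K) {T : Finset (Site d)}
    (hTc : (↑T : Set (Site d)) ∈ localCylinder (↑(S.V h) : Set (Site d)) ↑(S.ξ h)) :
    pinW (S.Wfull h e du) ↑(S.Rj h e du j) ↑T = S.Wt h e du j (obsV ↑T (S.envV h e)) := by
  have hRS : S.Rj h e du j ⊆ S.Sx h e du := Rj_subset_Sx S h e du hj.le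
  funext x
  unfold Wt Wfull
  by_cases hxR : x ∈ S.Rj h e du j
  · have hxS : x ∈ (↑(S.Sx h e du) : Set (Site d)) := Finset.mem_coe.2 (hRS hxR)
    rw [siteRestrW_apply_of_mem _ hxS]
    -- both sides read the pattern
    have hiff : x ∈ (↑(S.pat h e du j (obsV ↑T (S.envV h e))) : Set (Site d)) ↔ x ∈ (↑T : Set (Site d)) := by
      rw [Finset.mem_coe, Finset.mem_coe, pat, Finset.mem_union, Finset.mem_inter, mem_obsV_iff, Finset.mem_sdiff,
        Finset.mem_coe]
      by_cases hxV : x ∈ S.V h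
      · have h1 := hTc x (Finset.mem_coe.2 hxV)
        rw [Finset.mem_coe, Finset.mem_coe] at h1
        constructor
        · rintro (h2 | ⟨-, -, h3⟩)
          · exact h1.2 h2
          · exact absurd hxV h3
        · intro h2; exact Or.inl (h1.1 h2)
      · have hxenv : x ∈ S.envV h e := S.Rj_sdiff_subset_envV h e hdu hj (Finset.mem_sdiff.2 ⟨hxR, hxV⟩)
        constructor
        · rintro (h2 | ⟨⟨-, h3⟩, -, -⟩)
          · exact absurd (hV.ξ_sub h2) hxV
          · exact h3
        · intro h2; exact Or.inr ⟨⟨hxenv, h2⟩, hxR, hxV⟩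
    by_cases hxT : x ∈ (↑T : Set (Site d))
    · rw [pinW_apply_of_mem_of_mem _ (Finset.mem_coe.2 hxR) hxT,
        pinW_apply_of_mem_of_mem _ (Finset.mem_coe.2 hxR) (hiff.2 hxT)]
    · rw [pinW_apply_of_mem_of_not_mem _ (Finset.mem_coe.2 hxR) hxT,
        pinW_apply_of_mem_of_not_mem _ (Finset.mem_coe.2 hxR) (fun h' => hxT (hiff.1 h'))]
  · have hxV : x ∉ (↑(S.V h) : Set (Site d)) := fun h' => hxR (S.V_subset_Rj h e du j (Finset.mem_coe.1 h'))
    rw [pinW_apply_of_not_mem _ _ (fun h' => hxR (Finset.mem_coe.1 h'))]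
    by_cases hxS : x ∈ (↑(S.Sx h e du) : Set (Site d))
    · rw [siteRestrW_apply_of_mem _ hxS, siteRestrW_apply_of_mem _ hxS, pinW_apply_of_not_mem _ _ hxV,
        pinW_apply_of_not_mem _ _ (fun h' => hxR (Finset.mem_coe.1 h'))]
    · rw [siteRestrW_apply_of_not_mem _ hxS, siteRestrW_apply_of_not_mem _ hxS]
/-! ## The chain (36) -/

/-- **One step of the chain**: `μ(A'_j ∩ B_j ∩ G ∩ [ξ]) ≤ (1 − δ₂) μ(B_j ∩ G ∩ [ξ])` for `G` determined by the sites of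
level `j`. [cite: KozmaNitzan2024, §4 p. 31 ((36))] -/
theorem real_Aface_inter_le {δ₂ : ℝ} {j : ℕ} (hj : j < S.C.K) {G : Set (SiteConfig (Site d))}
    (hG : DeterminedBy G (↑(S.Rj h e du j) : Set (Site d))) :
    (prodBernoulli (S.Wfull h e du)).real (S.Aface h e du j ∩ (S.Bev h e du j δ₂ ∩ G ∩
        localCylinder (↑(S.V h) : Set (Site d)) ↑(S.ξ h))) ≤
      (1 - δ₂) * (prodBernoulli (S.Wfull h e du)).real (S.Bev h e du j δ₂ ∩ G ∩
        localCylinder (↑(S.V h) : Set (Site d)) ↑(S.ξ h)) := by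
  have hB : DeterminedBy (S.Bev h e du j δ₂ ∩ G ∩ localCylinder (↑(S.V h) : Set (Site d)) ↑(S.ξ h))
      (↑(S.Rj h e du j) : Set (Site d)) :=
    ((determinedBy_Bev S h e du j δ₂).inter hG).inter
      ((determinedBy_localCylinder _ _).mono (Finset.coe_subset.2 (S.V_subset_Rj h e du j)))
  refine prodBernoulli_real_inter_le_of_pinW_le _ _ (measurableSet_biUnion_siteConnIn _ _ _ _) hB fun T _ hTB => ?_
  obtain ⟨⟨hTB, -⟩, hTc⟩ := hTB
  have hTB' : (prodBernoulli (S.Wt h e du j (obsV ↑T (S.envV h e)))).real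
      (⋃ b ∈ S.C.Face (tgt e) du (j + 1), siteConn (zdGraph d) (0 : Site d) b) ≤ 1 - δ₂ := hTB
  rw [pinW_Wfull_eq_Wt hV hdu hj hTc]
  refine le_trans (measureReal_mono ?_ (measure_ne_top _ _)) hTB'
  rw [← Finset.set_biUnion_coe]
  exact biUnion_siteConnIn_subset_biUnion_siteConn _ _ _ _

/-- **The chain**: `μ(G_j ∩ [ξ]) ≤ (1 − δ₂)^j` for `j ≤ K`. [cite: KozmaNitzan2024, §4 p. 31 ((36))] -/
theorem real_Gev_le {δ₂ : ℝ} (hδ₂ : δ₂ ≤ 1) :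
    ∀ j ≤ S.C.K, (prodBernoulli (S.Wfull h e du)).real
      (S.Gev h e du δ₂ j ∩ localCylinder (↑(S.V h) : Set (Site d)) ↑(S.ξ h)) ≤ (1 - δ₂) ^ j
  | 0, _ => by rw [pow_zero]; exact measureReal_le_one
  | j + 1, hj => by
    set μ := prodBernoulli (S.Wfull h e du) with hμ
    set Cyl := localCylinder (↑(S.V h) : Set (Site d)) (↑(S.ξ h) : Set (Site d)) with hCyl
    have hj' : j < S.C.K := by omega
    have ih := real_Gev_le hδ₂ j hj'.le
    have e1 : μ.real (S.Gev h e du δ₂ (j + 1) ∩ Cyl) =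
        μ.real (S.Aface h e du j ∩ (S.Bev h e du j δ₂ ∩ S.Gev h e du δ₂ j ∩ Cyl)) := by
      congr 1
      ext σ
      constructor
      · rintro ⟨⟨hA, hB, hG⟩, hC⟩; exact ⟨hA, ⟨hB, hG⟩, hC⟩
      · rintro ⟨hA, ⟨hB, hG⟩, hC⟩; exact ⟨⟨hA, hB, hG⟩, hC⟩
    rw [e1]
    refine (real_Aface_inter_le hV hdu hj' (determinedBy_Gev S h e du δ₂ j)).trans ?_
    rw [pow_succ, mul_comm ((1 - δ₂) ^ j)]
    refine mul_le_mul_of_nonneg_left (le_trans (measureReal_mono ?_ (measure_ne_top _ _)) ih) (by linarith)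
    rintro σ ⟨⟨-, hG⟩, hC⟩
    exact ⟨hG, hC⟩
/-! ## (36)–(37): a bad direction is unlikely under `μ` -/

/-- Reaching `M_x` through the corridor forces all the `A'_j`. [cite: KozmaNitzan2024, §4 p. 31] -/
theorem mem_Aface_of_reach {σ : SiteConfig (Site d)} (hR : σ ∈ S.Reach h e du) {j : ℕ} (hj : j < S.C.K) :
    σ ∈ S.Aface h e du j := by
  have main : ∀ m, m < S.C.K → σ ∈ S.Aface h e du (S.C.K - 1 - m) := by
    intro m
    induction m with
    | zero => intro _; exact reach_subset_Aface hV hdu hR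
    | succ m ih =>
      intro hm
      have h1 := ih (by omega)
      have h2 : S.C.K - 1 - (m + 1) = S.C.K - 1 - m - 1 := by omega
      rw [h2]
      exact Aface_subset_Aface hV hdu (by omega) (by omega) h1
  have := main (S.C.K - 1 - j) (by omega)
  have h3 : S.C.K - 1 - (S.C.K - 1 - j) = j := by omega
  rwa [h3] at this

omit hV hdu in
/-- All `B_j` and all `A'_j` give `G_K`. [folklore] -/
theorem mem_Gev_of_forall {δ₂ : ℝ} {σ : SiteConfig (Site d)} (hB : ∀ j < S.C.K, σ ∈ S.Bev h e du j δ₂)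
    (hA : ∀ j < S.C.K, σ ∈ S.Aface h e du j) : ∀ j ≤ S.C.K, σ ∈ S.Gev h e du δ₂ j
  | 0, _ => Set.mem_univ _
  | j + 1, hj => ⟨hA j (by omega), hB j (by omega), mem_Gev_of_forall hB hA j (by omega)⟩

/-- **Step III inside Step IV**: a bad direction lies in every `B_j`. [cite: KozmaNitzan2024, §4 p. 30 (Step III)] -/
theorem bad_subset_Bev {δ₂ : ℝ} {R : ℕ}
    (htgt : ∀ (w : Site d → unitInterval) (Sfin D : Finset (Site d)) (lo hi : Site d)
      (T : Finset (Site d)) (o : Site d),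
      SiteFinSupp w Sfin → SiteIsSubbox w S.p D → D ⊆ Sfin → o ∈ Sfin → o ∉ D →
      Finset.Icc (lo - (R : Site d)) (hi + (R : Site d)) ⊆ D →
      IsTarget T lo hi D R (elongList d (2 * S.C.K) (by have := S.C.hK; omega)) → T ⊆ D → T.Nonempty →
      1 - δ₂ < (prodBernoulli w).real (⋃ b ∈ Finset.Icc lo hi, siteConn (zdGraph d) o b) →
      1 - S.δc < (prodBernoulli w).real (⋃ t ∈ T, siteConn (zdGraph d) o t))
    (hRs : 2 * R ≤ S.C.s) {j : ℕ} (hj : j < S.C.K) : ∀ σ ∈ S.bad h e du, σ ∈ S.Bev h e du j δ₂ := by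
  intro σ hσ
  by_contra hB
  simp only [Bev, Set.mem_setOf_eq, not_le] at hB
  exact hσ j hj (cond_of_face hV hdu htgt hRs hj _ hB)

/-- **(36)–(37) for one direction**: `μ(bad) ≤ (1 − δ₂)^K + ε'`, given the site Lemma 12 (`hcorr`, at `ε'`) and the site
target lemma (`htgt`). [cite: KozmaNitzan2024, §4 p. 31 ((36), (37))] -/
theorem real_bad_le {ε' δ₂ : ℝ} (hδ₂ : δ₂ ≤ 1) {R : ℕ}
    (hcorr : ∀ (T : CData d) (w : Site d → unitInterval), SiteCHyp T w S.p → T.r = S.C.r →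
      1 - S.δc < (prodBernoulli w).real
          (⋃ b ∈ Finset.Icc (T.c - ((3 * T.r : ℕ) : Site d)) (T.c + ((3 * T.r : ℕ) : Site d)),
            siteConnIn (zdGraph d) (↑T.Aset : Set (Site d)) T.o b) →
        1 - ε' < (prodBernoulli w).real
          (⋃ b ∈ T.Tn (3 * T.r), siteConnIn (zdGraph d) (↑T.Uset : Set (Site d)) T.o b))
    (htgt : ∀ (w : Site d → unitInterval) (Sfin D : Finset (Site d)) (lo hi : Site d)
      (T : Finset (Site d)) (o : Site d),
      SiteFinSupp w Sfin → SiteIsSubbox w S.p D → D ⊆ Sfin → o ∈ Sfin → o ∉ D →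
      Finset.Icc (lo - (R : Site d)) (hi + (R : Site d)) ⊆ D →
      IsTarget T lo hi D R (elongList d (2 * S.C.K) (by have := S.C.hK; omega)) → T ⊆ D → T.Nonempty →
      1 - δ₂ < (prodBernoulli w).real (⋃ b ∈ Finset.Icc lo hi, siteConn (zdGraph d) o b) →
      1 - S.δc < (prodBernoulli w).real (⋃ t ∈ T, siteConn (zdGraph d) o t))
    (hRs : 2 * R ≤ S.C.s) :
    (prodBernoulli (S.Wfull h e du)).real (S.bad h e du) ≤ ε' + (1 - δ₂) ^ S.C.K := by
  set μ := prodBernoulli (S.Wfull h e du) with hμ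
  set Cyl := localCylinder (↑(S.V h) : Set (Site d)) (↑(S.ξ h) : Set (Site d)) with hCyl
  have hreach : 1 - ε' < μ.real (S.Reach h e du) := reach_bound hV hdu hcorr
  have hRm : MeasurableSet (S.Reach h e du) := measurableSet_biUnion_siteConnIn _ _ _ _
  have hnull : μ.real Cylᶜ = 0 := by
    have : μ Cylᶜ = 0 := mem_ae_iff.1 (ae_cyl (S := S) (h := h) (e := e) (du := du))
    exact (measureReal_eq_zero_iff (measure_ne_top _ _)).2 this
  have h1 : μ.real (S.bad h e du) ≤ μ.real (S.bad h e du ∩ Cyl) + μ.real Cylᶜ := by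
    refine le_trans (measureReal_mono ?_ (measure_ne_top _ _)) (measureReal_union_le _ _)
    intro σ hσ
    by_cases h' : σ ∈ Cyl
    · exact Or.inl ⟨hσ, h'⟩
    · exact Or.inr h'
  have h2 : S.bad h e du ∩ Cyl ⊆ (S.Gev h e du δ₂ S.C.K ∩ Cyl) ∪ (S.Reach h e du)ᶜ := by
    rintro σ ⟨hσ, hC⟩
    by_cases hR : σ ∈ S.Reach h e du
    · exact Or.inl ⟨mem_Gev_of_forall (fun j hj => bad_subset_Bev hV hdu htgt hRs hj σ hσ)
        (fun j hj => mem_Aface_of_reach hV hdu hR hj) _ le_rfl, hC⟩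
    · exact Or.inr hR
  have h3 : μ.real (S.Reach h e du)ᶜ < ε' := by
    rw [probReal_compl_eq_one_sub hRm]; linarith
  calc μ.real (S.bad h e du) ≤ μ.real (S.bad h e du ∩ Cyl) + μ.real Cylᶜ := h1
    _ ≤ μ.real ((S.Gev h e du δ₂ S.C.K ∩ Cyl) ∪ (S.Reach h e du)ᶜ) + 0 := by
        rw [hnull]; exact add_le_add (measureReal_mono h2 (measure_ne_top _ _)) le_rfl
    _ ≤ μ.real (S.Gev h e du δ₂ S.C.K ∩ Cyl) + μ.real (S.Reach h e du)ᶜ := by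
        rw [add_zero]; exact measureReal_union_le _ _
    _ ≤ ε' + (1 - δ₂) ^ S.C.K := (add_le_add (real_Gev_le hV hdu hδ₂ _ le_rfl) h3.le).trans_eq (add_comm _ _)
/-! ## Back to `P^{site}_p`, and the sum over the onward directions: (33) -/

omit hV hdu in
/-- **`P^{site}_p(bad) = μ(bad)`**: a bad direction is determined by fresh conditioned sites, on which `μ` is the
density `p` (Step II, p. 29: "the result we proved in `Ω` is equivalent to the result in `ℤ^d`").
[cite: KozmaNitzan2024, §4 p. 29 (Step II), p. 31] -/
theorem real_bad_eq : (sitePercolation (Site d) S.p).real (S.bad h e du) =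
    (prodBernoulli (S.Wfull h e du)).real (S.bad h e du) := by
  have hK1 : S.C.K - 1 ≤ S.C.K := Nat.sub_le _ _
  have hdet := determinedBy_bad S h e du
  rw [sitePercolation_eq_prodBernoulli]
  refine prodBernoulli_real_eq_of_determinedBy _ _ (fun x hx => ?_) hdet hdet.measurableSet_of_finset
  obtain ⟨hx1, hx2⟩ := Finset.mem_sdiff.1 (Finset.mem_coe.1 hx)
  have hxS : x ∈ (↑(S.Sx h e du) : Set (Site d)) := Finset.mem_coe.2 (Rj_subset_Sx S h e du hK1 hx1)
  unfold Wfull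
  rw [siteRestrW_apply_of_mem _ hxS, pinW_apply_of_not_mem _ _ (fun h' => hx2 (Finset.mem_coe.1 h'))]

omit hV hdu in
/-- A failed examination has a bad onward direction. [cite: KozmaNitzan2024, §4 p. 27 (j_x), p. 31] -/
theorem fail_subset (S : SKSch d) (h : ProbeHistory (Option (Site d))) (e : Site 2 × MDir) :
    S.fail h e ⊆ ⋃ du ∈ S.onward h (tgt e), S.bad h e du := by
  intro σ hσ
  simp only [fail, Set.mem_setOf_eq, succV] at hσ
  push Not at hσ
  obtain ⟨du, hdu, hc⟩ := hσ
  simp only [Set.mem_iUnion, exists_prop]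
  refine ⟨du, hdu, ?_⟩
  exact forall_not_of_not_jIdx (P := fun j => S.cond h e du j (obsV σ (S.envV h e))) (by have := S.C.hK; omega) hc

omit hdu in
/-- **(33): the examination fails with probability at most `ε`** — after a valid history, given the site Lemma 12 at
`ε/8` (`hcorr`), the site target lemma with `δ_{L10} = δ₂ ≤ 1` and its `R ≤ s/2` (`htgt`), and `(1 − δ₂)^K + ε/8 ≤ ε/4`.
[cite: KozmaNitzan2024, §4 pp. 28–31 ((33), Steps I–IV)] -/
theorem fail_bound {ε δ₂ : ℝ} (hε : 0 ≤ ε) (hδ₂ : δ₂ ≤ 1) {R : ℕ}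
    (hcorr : ∀ (T : CData d) (w : Site d → unitInterval), SiteCHyp T w S.p → T.r = S.C.r →
      1 - S.δc < (prodBernoulli w).real
          (⋃ b ∈ Finset.Icc (T.c - ((3 * T.r : ℕ) : Site d)) (T.c + ((3 * T.r : ℕ) : Site d)),
            siteConnIn (zdGraph d) (↑T.Aset : Set (Site d)) T.o b) →
        1 - ε / 8 < (prodBernoulli w).real
          (⋃ b ∈ T.Tn (3 * T.r), siteConnIn (zdGraph d) (↑T.Uset : Set (Site d)) T.o b))
    (htgt : ∀ (w : Site d → unitInterval) (Sfin D : Finset (Site d)) (lo hi : Site d)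
      (T : Finset (Site d)) (o : Site d),
      SiteFinSupp w Sfin → SiteIsSubbox w S.p D → D ⊆ Sfin → o ∈ Sfin → o ∉ D →
      Finset.Icc (lo - (R : Site d)) (hi + (R : Site d)) ⊆ D →
      IsTarget T lo hi D R (elongList d (2 * S.C.K) (by have := S.C.hK; omega)) → T ⊆ D → T.Nonempty →
      1 - δ₂ < (prodBernoulli w).real (⋃ b ∈ Finset.Icc lo hi, siteConn (zdGraph d) o b) →
      1 - S.δc < (prodBernoulli w).real (⋃ t ∈ T, siteConn (zdGraph d) o t))
    (hRs : 2 * R ≤ S.C.s) (hKε : (1 - δ₂) ^ S.C.K + ε / 8 ≤ ε / 4) :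
    (sitePercolation (Site d) S.p).real (S.fail h e) ≤ ε := by
  have hcard : ((S.onward h (tgt e)).card : ℝ) ≤ 4 := by
    have h1 : (S.onward h (tgt e)).card ≤ Fintype.card MDir := Finset.card_le_univ _
    have h2 : Fintype.card MDir = 4 := by simp [MDir, Fintype.card_prod, Fintype.card_bool, Fintype.card_fin]
    have h3 : (S.onward h (tgt e)).card ≤ 4 := h2 ▸ h1
    exact_mod_cast h3
  calc (sitePercolation (Site d) S.p).real (S.fail h e)
      ≤ (sitePercolation (Site d) S.p).real (⋃ du ∈ S.onward h (tgt e), S.bad h e du) :=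
        measureReal_mono (fail_subset S h e) (measure_ne_top _ _)
    _ ≤ ∑ du ∈ S.onward h (tgt e), (sitePercolation (Site d) S.p).real (S.bad h e du) :=
        measureReal_biUnion_finset_le _ _
    _ ≤ ∑ du ∈ S.onward h (tgt e), ε / 4 := by
        refine Finset.sum_le_sum fun du hdu' => ?_
        rw [real_bad_eq]
        exact (real_bad_le hV hdu' hδ₂ hcorr htgt hRs).trans (by rw [add_comm]; exact hKε)
    _ = (S.onward h (tgt e)).card * (ε / 4) := by rw [Finset.sum_const, nsmul_eq_mul]
    _ ≤ 4 * (ε / 4) := mul_le_mul_of_nonneg_right hcard (by linarith)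
    _ = ε := by ring

end Setting

end SKSch

end SiteKN

end Summit.CriticalPhenomena.PercolationContinuityZ3.Theorems.Transplant

end
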